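import Summits.MatrixMultiplication.MatrixMultiplication.Theorems.ObstructionCalculusSlots

/-!
# ObstructionDescent — the obstruction calculus, PART 4 of 5: `ObstructionCalculusPadInheritance`

LANDING SPLIT (decomp-mm-lander-1 g1, 2026-08-30; mechanical, for the 400-line lint; REQUESTS #16-ii, decomp-mm SUMMON
Tier 3 (10)) of «Part 1 + Part 1b — the obstruction calculus on cubic tensor formats» of the lens-3 gen-8 kernel
`DegreeFiltration_g8_tree.lean` (sha256 `132d565c…aec8`, 2383 lines; critic-CLEARED decomp-mm STATUS l.348/365; rc0, the
calculus parts sorry-free).  This file = §C «PadInheritance» (`hwvSpace_le_orbitVanishing_padMM_of_lt_card`) (source lines 870–964),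
copied byte-identically inside the source namespace `Summit.MatrixMultiplication.MatrixMultiplication.Theorems.ObstructionCalculus`
with the source header (`noncomputable section`, opens).  Route-free: imports Literature / the previous part only, NO `Theses`
file (lint `theses-cone`).  The five parts Action → Invariants → Slots → PadInheritance → Locality form one import chain and
SUPPORT the crux `NoOccurrenceObstruction` (item `stmt-MatrixMultiplication-29040`, route-MatrixMultiplication-ObstructionDescent)
WITHOUT closing anything; nothing here proves ω = 2.  Full mathematical commentary: the module docstring of the source kernel
(HOME/decomp-mm-lens-3/pkg-ObstructionDescent-g8/) and the docstrings below.
-/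

set_option linter.dupNamespace false
set_option autoImplicit false

noncomputable section

open scoped BigOperators
open Filter Asymptotics Finset

namespace Summit.MatrixMultiplication.MatrixMultiplication.Theorems.ObstructionCalculus

open Literature.Computability.AlgebraicComplexity (triad triad_apply tensorRank matMulTensor unitTensor
  exists_eq_sum_triad_of_tensorRank_le actTensor actTensor_apply actTensor_actTensor
  tensorRank_le_card_of_eq_sum)

section PadInheritance

variable {m : ℕ}

/-- **PadInheritance** (inheritance for the subspace variety `Sub_{n²,n²,n²} ∋ pad_m⟨n,n,n⟩`): a type
with more than `n²` non-zero parts in some slot has ALL its weight vectors vanishing on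
`GL_m³ · pad_m⟨n,n,n⟩`.  Proof: Borel normal form of the `n²` relevant columns of the slot matrix, transport
of the slot support to a set `S` of `≤ n²` coordinates, and the torus trick (scaling the coordinates off
`S` by `2` fixes the tensor but multiplies a weight vector by `2^{Σ_{a∉S} λ_a} ≠ 1`).
[cite: BurgisserIkenmeyer2011, §3; Landsberg 2012, §7.4 (inheritance)] -/
theorem hwvSpace_le_orbitVanishing_padMM_of_lt_card {n : ℕ} (h : n * n ≤ m)
    (Λ : Fin 3 → Fin m → ℕ) (d : ℕ) {s : Fin 3}
    (hs : n * n < (Finset.univ.filter fun a => Λ s a ≠ 0).card) :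
    hwvSpace Λ d ≤ orbitVanishing (padMM ℂ n m h) := by
  classical
  intro f hf A B C _ _ _
  -- (1) Borel normal form of the first `n²` columns of the slot-`s` matrix
  obtain ⟨b, hb, S, hSk, hS⟩ := exists_borel_mulVec_eq_zero (m := m) (n * n)
    fun idx a => slotMat s A B C a (Fin.castLE h idx)
  -- (2) the transformed tensor and its slot support
  obtain ⟨A', B', C', hact, hmat⟩ := exists_slotAct_actTensor_eq b A B C (padMM ℂ n m h) s
  obtain ⟨T, hT⟩ : ∃ T : Finset (Fin m), T = Finset.univ.filter fun a : Fin m => (a : ℕ) < n * n :=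
    ⟨_, rfl⟩
  have hpadT : ∀ a b c, padMM ℂ n m h a b c ≠ 0 → slot s (a, b, c) ∈ T := fun a b c hne =>
    hT ▸ Finset.mem_filter.2 ⟨Finset.mem_univ _, slot_lt_of_padMM_ne_zero h s a b c hne⟩
  have hG : ∀ a, a ∉ S → ∀ i ∈ T, slotMat s A' B' C' a i = 0 := by
    intro a haS i hi
    have hi' : (i : ℕ) < n * n := by
      rw [hT] at hi
      exact (Finset.mem_filter.1 hi).2
    have hiC : Fin.castLE h ⟨i, hi'⟩ = i := Fin.ext rfl
    have := hS ⟨i, hi'⟩ a haS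
    change ∑ l, b a l * slotMat s A B C l (Fin.castLE h ⟨i, hi'⟩) = 0 at this
    rw [hiC] at this
    rw [hmat, Matrix.mul_apply]
    exact this
  obtain ⟨t₂, ht₂⟩ : ∃ t₂ : Tensor ℂ m, t₂ = actTensor A' B' C' (padMM ℂ n m h) := ⟨_, rfl⟩
  have hsupp : ∀ a b c, t₂ a b c ≠ 0 → slot s (a, b, c) ∈ S := by
    rw [ht₂]
    exact slot_mem_of_actTensor_ne_zero s hpadT hG
  -- (3) a coordinate outside `S` carrying weight (pigeonhole: `ℓ(λ⁽ˢ⁾) > n² ≥ |S|`)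
  obtain ⟨a₀, ha₀S, ha₀⟩ : ∃ a₀, a₀ ∉ S ∧ Λ s a₀ ≠ 0 := by
    by_contra hno
    push Not at hno
    have hsub : (Finset.univ.filter fun a => Λ s a ≠ 0) ⊆ S := fun a ha => by
      by_contra haS
      exact (Finset.mem_filter.1 ha).2 (hno a haS)
    exact absurd ((Finset.card_le_card hsub).trans hSk) (not_le.2 hs)
  -- (4) the torus trick: scale the coordinates off `S` by `2`
  obtain ⟨δN, hδN⟩ : ∃ δN : Fin m → ℕ, δN = fun a => if a ∈ S then 1 else 2 := ⟨_, rfl⟩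
  obtain ⟨δ, hδ⟩ : ∃ δ : Fin m → ℂ, δ = fun a => (δN a : ℂ) := ⟨_, rfl⟩
  have hδ0 : ∀ a, δ a ≠ 0 := by
    intro a
    rw [hδ, hδN]
    dsimp only
    split_ifs <;> norm_num
  have hD : Matrix.diagonal δ ∈ borel m := diagonal_mem_borel hδ0
  have hfix : slotAct s (Matrix.diagonal δ) t₂ = t₂ := by
    rw [slotAct_diagonal]
    funext a b c
    by_cases hz : t₂ a b c = 0
    · rw [hz, mul_zero]
    · have h1 : δ (slot s (a, b, c)) = 1 := by
        rw [hδ, hδN]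
        dsimp only
        rw [if_pos (hsupp a b c hz), Nat.cast_one]
      rw [h1, one_mul]
  have hχ : weightChar (Λ s) (Matrix.diagonal δ) ≠ 1 := by
    rw [weightChar_diagonal]
    have hcast : (∏ i, δ i ^ Λ s i) = ((∏ i, δN i ^ Λ s i : ℕ) : ℂ) := by
      rw [hδ, Nat.cast_prod]
      exact Finset.prod_congr rfl fun i _ => by rw [Nat.cast_pow]
    rw [hcast]
    intro h1c
    have h1 : ∏ i, δN i ^ Λ s i = 1 := by exact_mod_cast h1c
    have hdvd : 2 ∣ δN a₀ ^ Λ s a₀ := by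
      rw [hδN]
      dsimp only
      rw [if_neg ha₀S]
      exact dvd_pow_self 2 ha₀
    have h2 := hdvd.trans (Finset.dvd_prod_of_mem (fun i => δN i ^ Λ s i) (Finset.mem_univ a₀))
    rw [h1] at h2
    exact absurd (Nat.le_of_dvd one_pos h2) (by norm_num)
  -- (5) `f(t₂) = χ·f(t₂)` with `χ ≠ 1`, so `f(t₂) = 0`; and `f(t₂) = Λ_s(b)·f((A,B,C)·pad)` with `Λ_s(b) ≠ 0`
  have h2 : evalT t₂ f = 0 := by
    have heq := evalT_slotAct hf hD t₂ s
    rw [hfix] at heq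
    have h' : (1 - weightChar (Λ s) (Matrix.diagonal δ)) * evalT t₂ f = 0 := by
      rw [sub_mul, one_mul, ← heq, sub_self]
    exact (mul_eq_zero.1 h').resolve_left (sub_ne_zero.2 hχ.symm)
  have h3 := evalT_slotAct hf hb (actTensor A B C (padMM ℂ n m h)) s
  rw [hact, ← ht₂, h2] at h3
  exact ((mul_eq_zero.1 h3.symm).resolve_left (weightChar_ne_zero (Λ s) hb))

end PadInheritance

end Summit.MatrixMultiplication.MatrixMultiplication.Theorems.ObstructionCalculus

end
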